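import Mathlib
import Summits.NavierStokesRegularity.NavierStokesRegularity.Theorems.EulerZoomLiouvillePowerGaugeEulerLiouvilleSelfSimilarGradientPotential
import Summits.NavierStokesRegularity.NavierStokesRegularity.Theorems.EulerZoomLiouvillePowerGaugeEulerLiouvilleSelfSimilarProfileEquation
import Summits.NavierStokesRegularity.NavierStokesRegularity.Theorems.EulerZoomLiouvillePowerGaugeEulerLiouvilleSelfSimilarBoundedRigidity
import Summits.NavierStokesRegularity.NavierStokesRegularity.Theorems.EulerZoomLiouvillePowerGaugeEulerLiouvilleEnergySaturationMember
import Literature.Analysis.FluidPDE.NSBoundedMildOseenClassical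
import Literature.Analysis.FluidPDE.SverakLandauConformalCalc
import HarnessLib.Audit

/-!
# Rung C1 of the crux `EulerZoomLiouville.PowerGaugeEulerLiouville`, weak → classical bridge II: A CLASS MEMBER WITH A
# `C²` VELOCITY PROFILE SOLVES CIV (3.3) CLASSICALLY FOR SOME `C¹` PRESSURE — the bounded classical stratum needs
# hypotheses on `V` ALONE

Route №10 `EulerZoomLiouville` (NavierStokesRegularity), crux E = stmt-NavierStokesRegularity-19832, tenure rung C1,
registered residue `stub_selfSimilarExtremalRest`.  Lineage ns-typeII-p2 (gen 8), on `…SelfSimilarGradientPotential` (this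
gen), the lineage's weak profile equation `ProfileEquation.weak_profile_equation` and tonight's pressure-free rigidity
theorem `NoDrift.selfSimilar_ae_eq_zero_of_smooth_of_bounded_of_gaugeA`.

* `integral_pressure_mul_divergence_eq` — for a distributional Euler pair on the slab that is exactly self-similar with
  profile `(V, P)`, `V ∈ C²`, `P ∈ L¹_loc`: `∫ P div η = ∫ ⟪DV(γy + V) + (1−γ)V, η⟫` for every test field `η` — the weak
  profile equation integrated by parts on the smooth side (`∇P = −(DV·W + (1−γ)V)` in `𝒟'`);
* **`exists_isSelfSimilarEulerProfile_of_contDiff`** — hence there is a `C¹` function `P̃` with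
  `IsSelfSimilarEulerProfile γ 0 V P̃` (CIV (3.3) CLASSICALLY): the distributional gradient is a `C¹` field, so it is
  curl-free and integrates along segments (`WeakToClassical.exists_potential_of_weakGradient`); `div V = 0` classically
  from the weak divergence-freeness of the profile.  The member's own pressure representative `P` is not touched (it is
  only a.e.-defined; `P =ᵐ P̃ + const` is true but not needed);
* **`selfSimilar_ae_eq_zero_of_smooth_bounded_profile`** — MEMBER LEVEL, crux hypotheses verbatim (`0 < ρ < 1`; the
  weak-gradient hypothesis of the class is not even needed) + exact self-similarity: if the velocity profile `V` is
  `C^∞` with `‖V‖ ≤ M` and `‖DV‖ ≤ K`, the member vanishes a.e. on `(−∞,0) × ℝ³`.  NO hypothesis on the pressure profile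
  AT ALL (neither regularity nor normalisation), no far field, nothing on the stagnation set: the bounded classical
  stratum of the crux is a condition on `V ∈ C^∞ ∩ L^∞ ∩ Ẇ^{1,∞}` alone.

WHAT THIS IS NOT: not NS, not E, not rung C1 — the weak (`H¹_loc`) class and smooth-but-unbounded profiles are untouched.
[folklore; ChaeShvydkoy2013 §2.1 (2.1) (the distributional profile equation); ConstantinIgnatovaVicol2026Putative §3.1.1
(3.3)]
-/

noncomputable section

-- flat `Theorems/<Route><Decl>…` files of one crux share the namespace of the crux (tree convention)
set_option linter.dupNamespace false

open MeasureTheory Set Filter Topology Metric Function InnerProductSpace TopologicalSpace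
open scoped RealInnerProductSpace NNReal ENNReal ContDiff

namespace Summit.NavierStokesRegularity.NavierStokesRegularity.Theorems.PowerGaugeEulerLiouville.WeakToClassical

open Literature.Analysis Literature.Analysis.FluidPDE Literature.Analysis.FunctionSpaces
open Summit.NavierStokesRegularity.NavierStokesRegularity.Theorems.PowerGaugeEulerLiouville.ProfileEquation

/-! ### The pressure gradient of a smooth profile, in the sense of distributions -/

/-- **`∇P = −(DV·(γy + V) + (1−γ)V)` in the sense of distributions.**  For a distributional Euler pair `(u, p)` on the
slab `(−∞,0) × ℝ³` that is exactly self-similar with profile `(V, P)` (`u(τ) = selfSimilarCollapse γ 0 V τ`,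
`p(τ) = selfSimilarCollapsePressure γ 0 P τ`), `V ∈ C²`, `P ∈ L¹_loc`, and every test field `η`:
`∫ P div η = ∫ ⟪DV(γy + V) + (1−γ)V, η⟫` — the weak profile equation (`ProfileEquation.weak_profile_equation`) with the
two smooth transport terms integrated by parts (`integral_inner_convect_add_eq_zero`; `div V = 0`, `div y = 3` = `Sverak2011.divergence_id_three`).
[folklore; cf. ChaeShvydkoy2013 §2.1 eq. (2.1)] -/
theorem integral_pressure_mul_divergence_eq {γ : ℝ}
    {u : ℝ → EuclideanSpace ℝ (Fin 3) → EuclideanSpace ℝ (Fin 3)} {p : ℝ → EuclideanSpace ℝ (Fin 3) → ℝ}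
    (hsol : IsDistributionalNSSolutionOn (slab (EuclideanSpace ℝ (Fin 3)) (Iio 0) isOpen_Iio) 0 0 u p)
    {V : EuclideanSpace ℝ (Fin 3) → EuclideanSpace ℝ (Fin 3)} {P : EuclideanSpace ℝ (Fin 3) → ℝ}
    (hu : ∀ τ : ℝ, τ < 0 → u τ = selfSimilarCollapse γ 0 V τ)
    (hp : ∀ τ : ℝ, τ < 0 → p τ = selfSimilarCollapsePressure γ 0 P τ)
    (hV : ContDiff ℝ 2 V) (hP : LocallyIntegrable P volume)
    {η : EuclideanSpace ℝ (Fin 3) → EuclideanSpace ℝ (Fin 3)}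
    (hη : IsTestFunctionOn (⊤ : Opens (EuclideanSpace ℝ (Fin 3))) η) :
    ∫ y, P y * VectorCalculus.divergence η y =
      ∫ y, ⟪fderiv ℝ V y (γ • y + V y) + (1 - γ) • V y, η y⟫ := by
  have hV1 : ContDiff ℝ 1 V := hV.of_le (by norm_cast)
  have hVc : Continuous V := hV.continuous
  have hDVc : Continuous (fderiv ℝ V) := hV1.continuous_fderiv one_ne_zero
  have hη1 : ContDiff ℝ 1 η := hη.contDiff.of_le (by exact_mod_cast le_top)
  have hηc : HasCompactSupport η := hη.hasCompactSupport
  have hηcont : Continuous η := hη.contDiff.continuous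
  have hDηc : Continuous (fderiv ℝ η) := hη1.continuous_fderiv one_ne_zero
  have hDηcs : HasCompactSupport (fderiv ℝ η) := hηc.fderiv (𝕜 := ℝ)
  -- the weak profile equation
  have hVli : LocallyIntegrable V volume := hVc.locallyIntegrable
  have hV2li : LocallyIntegrable (fun y => ‖V y‖ ^ 2) volume := (hVc.norm.pow 2).locallyIntegrable
  have hw := weak_profile_equation hsol hu hp hVli hV2li hP hη
  -- `div V = 0` classically
  have hdiv : VectorCalculus.IsDivFree V :=
    IsWeaklyDivFree.isDivFree_of_contDiff hV1 (profile_isWeaklyDivFree hsol hu hVli)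
  -- integrability of the pieces
  have hsuppη : ∀ {f : EuclideanSpace ℝ (Fin 3) → ℝ}, Continuous f → (∀ y, η y = 0 → f y = 0) → Integrable f volume :=
    fun hf h0 => hf.integrable_of_hasCompactSupport (hηc.mono fun y hy => by contrapose! hy; simp_all)
  have hsuppDη : ∀ {f : EuclideanSpace ℝ (Fin 3) → ℝ}, Continuous f → (∀ y, fderiv ℝ η y = 0 → f y = 0) →
      Integrable f volume :=
    fun hf h0 => hf.integrable_of_hasCompactSupport (hDηcs.mono fun y hy => by contrapose! hy; simp_all)
  have hiT1 : Integrable (fun y => ⟪V y, fderiv ℝ η y (V y)⟫) volume :=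
    hsuppDη (hVc.inner (hDηc.clm_apply hVc)) fun y hy => by simp [hy]
  have hiT2 : Integrable (fun y => P y * VectorCalculus.divergence η y) volume := by
    have hdc : Continuous (VectorCalculus.divergence η) := continuous_divergence hDηc
    have hdcs : HasCompactSupport (VectorCalculus.divergence η) := by
      refine hηc.mono' fun x hx => ?_
      contrapose! hx
      simp [divergence_eq_zero_of_notMem_tsupport hx]
    have := hP.integrable_smul_right_of_hasCompactSupport hdc hdcs
    simpa [smul_eq_mul] using this
  have hiT3 : Integrable (fun y => γ * ⟪V y, fderiv ℝ η y y⟫) volume :=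
    (hsuppDη (hVc.inner (hDηc.clm_apply continuous_id)) fun y hy => by simp [hy]).const_mul γ
  have hiT4 : Integrable (fun y => (4 * γ - 1) * ⟪V y, η y⟫) volume :=
    (hsuppη (hVc.inner hηcont) fun y hy => by simp [hy]).const_mul _
  have hiA : Integrable (fun y => ⟪fderiv ℝ V y (V y), η y⟫) volume :=
    hsuppη ((hDVc.clm_apply hVc).inner hηcont) fun y hy => by simp [hy]
  have hiC : Integrable (fun y => ⟪fderiv ℝ V y y, η y⟫) volume :=
    hsuppη ((hDVc.clm_apply continuous_id).inner hηcont) fun y hy => by simp [hy]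
  have hiI : Integrable (fun y => ⟪V y, η y⟫) volume :=
    hsuppη (hVc.inner hηcont) fun y hy => by simp [hy]
  -- split the weak equation
  have h12 : Integrable (fun y => ⟪V y, fderiv ℝ η y (V y)⟫ + P y * VectorCalculus.divergence η y) volume :=
    hiT1.add hiT2
  have h123 : Integrable (fun y => ⟪V y, fderiv ℝ η y (V y)⟫ + P y * VectorCalculus.divergence η y +
      γ * ⟪V y, fderiv ℝ η y y⟫) volume := h12.add hiT3
  have hw' : (∫ y, ⟪V y, fderiv ℝ η y (V y)⟫) + (∫ y, P y * VectorCalculus.divergence η y) +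
      γ * (∫ y, ⟪V y, fderiv ℝ η y y⟫) + (4 * γ - 1) * ∫ y, ⟪V y, η y⟫ = 0 := by
    rw [integral_add h123 hiT4, integral_add h12 hiT3, integral_add hiT1 hiT2, integral_const_mul,
      integral_const_mul] at hw
    exact hw
  -- integration by parts of the two transport terms
  have hB1 := integral_inner_convect_add_eq_zero hV1 hV1 hη1 hηc
  have hB2 := integral_inner_convect_add_eq_zero (u := fun y : EuclideanSpace ℝ (Fin 3) => y) contDiff_id hV1 hη1 hηc
  simp only [convect_apply, hdiv _, zero_mul, integral_zero, add_zero] at hB1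
  simp only [convect_apply, Sverak2011.divergence_id_three] at hB2
  rw [integral_const_mul] at hB2
  -- the right-hand side, expanded
  have hGA : Integrable (fun y => γ * ⟪fderiv ℝ V y y, η y⟫ + ⟪fderiv ℝ V y (V y), η y⟫) volume :=
    (hiC.const_mul γ).add hiA
  have hrhs : ∫ y, ⟪fderiv ℝ V y (γ • y + V y) + (1 - γ) • V y, η y⟫ =
      γ * (∫ y, ⟪fderiv ℝ V y y, η y⟫) + (∫ y, ⟪fderiv ℝ V y (V y), η y⟫) + (1 - γ) * ∫ y, ⟪V y, η y⟫ := by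
    have e : ∫ y, ⟪fderiv ℝ V y (γ • y + V y) + (1 - γ) • V y, η y⟫ =
        ∫ y, (γ * ⟪fderiv ℝ V y y, η y⟫ + ⟪fderiv ℝ V y (V y), η y⟫ + (1 - γ) * ⟪V y, η y⟫) := by
      refine integral_congr_ae (Eventually.of_forall fun y => ?_)
      simp only [map_add, map_smul, inner_add_left, real_inner_smul_left]
    rw [e, integral_add hGA (hiI.const_mul _), integral_add (hiC.const_mul γ) hiA, integral_const_mul,
      integral_const_mul]
  rw [hrhs]
  linear_combination hw' - hB1 - γ * hB2

/-- **A CLASS MEMBER'S `C²` VELOCITY PROFILE SOLVES CIV (3.3) CLASSICALLY FOR SOME `C¹` PRESSURE.**  For a distributional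
Euler pair on the slab `(−∞,0) × ℝ³`, exactly self-similar with profile `(V, P)`, `V ∈ C²`, `P ∈ L¹_loc`: there is
`P̃ ∈ C¹` with `IsSelfSimilarEulerProfile γ 0 V P̃`.  (The field `G = DV(γy + V) + (1−γ)V` is `C¹` and is `−∇P` in
`𝒟'`, hence has symmetric derivative and a segment potential `Q` with `∇Q = G`; take `P̃ = −Q`; `div V = 0`
classically from the weak divergence-freeness.) [folklore; ConstantinIgnatovaVicol2026Putative §3.1.1 (3.3)] -/
theorem exists_isSelfSimilarEulerProfile_of_contDiff {γ : ℝ}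
    {u : ℝ → EuclideanSpace ℝ (Fin 3) → EuclideanSpace ℝ (Fin 3)} {p : ℝ → EuclideanSpace ℝ (Fin 3) → ℝ}
    (hsol : IsDistributionalNSSolutionOn (slab (EuclideanSpace ℝ (Fin 3)) (Iio 0) isOpen_Iio) 0 0 u p)
    {V : EuclideanSpace ℝ (Fin 3) → EuclideanSpace ℝ (Fin 3)} {P : EuclideanSpace ℝ (Fin 3) → ℝ}
    (hu : ∀ τ : ℝ, τ < 0 → u τ = selfSimilarCollapse γ 0 V τ)
    (hp : ∀ τ : ℝ, τ < 0 → p τ = selfSimilarCollapsePressure γ 0 P τ)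
    (hV : ContDiff ℝ 2 V) (hP : LocallyIntegrable P volume) :
    ∃ P' : EuclideanSpace ℝ (Fin 3) → ℝ, IsSelfSimilarEulerProfile γ 0 V P' := by
  set G : EuclideanSpace ℝ (Fin 3) → EuclideanSpace ℝ (Fin 3) := fun y => fderiv ℝ V y (γ • y + V y) + (1 - γ) • V y
    with hG
  have hV1 : ContDiff ℝ 1 V := hV.of_le (by norm_cast)
  have hG1 : ContDiff ℝ 1 G := by
    have h1 : ContDiff ℝ 1 (fderiv ℝ V) := hV.fderiv_right (m := 1) (by norm_cast)
    exact (h1.clm_apply ((contDiff_id.const_smul γ).add hV1)).add (hV1.const_smul _)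
  have hweak : ∀ η : EuclideanSpace ℝ (Fin 3) → EuclideanSpace ℝ (Fin 3),
      IsTestFunctionOn (⊤ : Opens (EuclideanSpace ℝ (Fin 3))) η →
      ∫ y, P y * VectorCalculus.divergence η y = ∫ y, ⟪G y, η y⟫ :=
    fun η hη => integral_pressure_mul_divergence_eq hsol hu hp hV hP hη
  obtain ⟨Q, hQ1, hQ⟩ := exists_potential_of_weakGradient hG1 hweak
  have hdiv : VectorCalculus.IsDivFree V :=
    IsWeaklyDivFree.isDivFree_of_contDiff hV1 (profile_isWeaklyDivFree hsol hu hV.continuous.locallyIntegrable)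
  refine ⟨fun y => -Q y, ⟨hV, hQ1.neg, fun y => ?_, hdiv⟩⟩
  have hgrad : gradient (fun y => -Q y) y = -G y := by
    have h : HasGradientAt Q (G y) y := by
      rw [← hQ y]; exact (hQ1.differentiable one_ne_zero y).hasGradientAt
    have hn : HasGradientAt (fun y => -Q y) (-G y) y := by
      rw [hasGradientAt_iff_hasFDerivAt] at h ⊢
      have h2 := h.neg
      rw [← map_neg] at h2
      exact h2
    exact hn.gradient
  rw [hgrad, sub_zero]
  show (1 - γ) • V y + fderiv ℝ V y (γ • y + V y) + -(fderiv ℝ V y (γ • y + V y) + (1 - γ) • V y) = 0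
  abel

/-! ### Member level: the bounded classical stratum as a condition on `V` alone -/

/-- **THE BOUNDED CLASSICAL STRATUM OF `stub_selfSimilarExtremalRest` IS A CONDITION ON THE VELOCITY PROFILE ALONE.**
Crux hypotheses verbatim (`(u, p)` a suitable weak Euler pair on `(−∞,0) × ℝ³` in Seregin's power-gauged class, exponent
`0 < ρ < 1`; the weak spatial gradient `H` enters only through the gauge inequality) + exact self-similarity with profile
`(V, P)`: if `V ∈ C^∞` with `‖V‖ ≤ M` and `‖DV‖ ≤ K`, then `u = 0` a.e. on `(−∞,0) × ℝ³`.  NOTHING is assumed about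
the pressure profile `P` (its `C¹` replacement is manufactured by `exists_isSelfSimilarEulerProfile_of_contDiff` from
the member's distributional Euler identity and `P ∈ L¹_loc`, which the `D`-gauge supplies), nothing about the far field,
the stagnation set or a normalisation; the `A`-gauge kills the constants (`…_of_gaugeA`). [folklore] -/
theorem selfSimilar_ae_eq_zero_of_smooth_bounded_profile {ρ : ℝ} (hρ : 0 < ρ) (hρ1 : ρ < 1)
    {u : ℝ → EuclideanSpace ℝ (Fin 3) → EuclideanSpace ℝ (Fin 3)} {p : ℝ → EuclideanSpace ℝ (Fin 3) → ℝ}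
    {H : ℝ → EuclideanSpace ℝ (Fin 3) → EuclideanSpace ℝ (Fin 3) →L[ℝ] EuclideanSpace ℝ (Fin 3)} {c : ℝ≥0}
    (hsw : IsSuitableWeakSolutionOn (slab (EuclideanSpace ℝ (Fin 3)) (Iio 0) isOpen_Iio) 0 0 u p)
    (hgauge : ∀ a : ℝ, 0 < a →
      ENNReal.ofReal (a ^ (2 * ρ)) * cknA a (0 : ℝ × EuclideanSpace ℝ (Fin 3)) u +
          ENNReal.ofReal (a ^ ρ) * cknE a (0 : ℝ × EuclideanSpace ℝ (Fin 3)) H +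
        ENNReal.ofReal (a ^ (2 * ρ)) * cknD a (0 : ℝ × EuclideanSpace ℝ (Fin 3)) p ≤ (c : ℝ≥0∞))
    {V : EuclideanSpace ℝ (Fin 3) → EuclideanSpace ℝ (Fin 3)} {P : EuclideanSpace ℝ (Fin 3) → ℝ}
    (hu : ∀ τ : ℝ, τ < 0 → u τ = selfSimilarCollapse (1 / (2 + ρ)) 0 V τ)
    (hp : ∀ τ : ℝ, τ < 0 → p τ = selfSimilarCollapsePressure (1 / (2 + ρ)) 0 P τ)
    (hV : ContDiff ℝ ∞ V) {M K : ℝ} (hM : ∀ y, ‖V y‖ ≤ M) (hK : ∀ y, ‖fderiv ℝ V y‖ ≤ K) :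
    uncurry u =ᵐ[volume.restrict (Iio (0 : ℝ) ×ˢ (univ : Set (EuclideanSpace ℝ (Fin 3))))] 0 := by
  -- the `A`- and `D`-gauges separately
  have hA : ∀ a : ℝ, 0 < a → ENNReal.ofReal (a ^ (2 * ρ)) *
      cknA a (0 : ℝ × EuclideanSpace ℝ (Fin 3)) u ≤ (c : ℝ≥0∞) :=
    fun a ha => le_trans (le_trans le_self_add le_self_add) (hgauge a ha)
  have hD : ∀ a : ℝ, 0 < a → ENNReal.ofReal (a ^ (2 * ρ)) *
      cknD a (0 : ℝ × EuclideanSpace ℝ (Fin 3)) p ≤ (c : ℝ≥0∞) :=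
    fun a ha => le_trans le_add_self (hgauge a ha)
  -- `P ∈ L¹_loc` from the `D`-gauge
  have hpm : AEStronglyMeasurable (uncurry p)
      (volume.restrict (Iio (0 : ℝ) ×ˢ (univ : Set (EuclideanSpace ℝ (Fin 3))))) := by
    have := hsw.distributional.2.2.1.aestronglyMeasurable
    simpa [slab] using this
  have hPm := aestronglyMeasurable_pressureProfile hpm hp
  have hDprof := profile_pressure_weight_of_gaugeD hρ hρ1 hpm hp hD
  have hP1 : LocallyIntegrable P volume :=
    EnergySaturation.locallyIntegrable_pressure_of_weight hρ1 hPm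
      (ENNReal.mul_ne_top ENNReal.ofReal_ne_top ENNReal.coe_ne_top) hDprof
  -- a classical pressure for the smooth profile, then the pressure-free rigidity theorem
  obtain ⟨P', hprof⟩ := exists_isSelfSimilarEulerProfile_of_contDiff hsw.distributional hu hp (hV.of_le (by norm_cast)) hP1
  exact NoDrift.selfSimilar_ae_eq_zero_of_smooth_of_bounded_of_gaugeA hρ hu hA hV hprof hM hK

end Summit.NavierStokesRegularity.NavierStokesRegularity.Theorems.PowerGaugeEulerLiouville.WeakToClassical

end
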